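import Literature.IUT.LogThetaLattice.VerticallyCoricLGP
import Literature.IUT.LogThetaLattice.TensorPackets
import Literature.IUT.LogThetaLattice.LogLinkIterates
import Literature.IUT.HodgeArakelov.SplittingMonoidValues
import Literature.AnabelianGeometry.AbsoluteAnabelian.LogShellsOfUnitLog
import Mathlib.Analysis.Normed.Field.UnitBall
import HarnessLib

/-!
# [IUTchIII] Proposition 3.5 (ii) (c) "(Bad Primes)" and the closing "log-Kummer correspondence" at the
# genuine model of a bad place — proof-only companion of `VerticallyCoricLGP.lean` (abc-iut cell, layer L6,
# slice [IUTchIII] §3; node IUTchIII:Prop3.5(ii); sibling of `VerticallyCoricLGPNonarch/Packets/Arch.lean`)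

S. Mochizuki, *Inter-universal Teichmüller theory III*, kurims manuscript (May 2020), §3, Proposition 3.5
(ii) (c), pp. 105–106, read on the page [claim: Mochizuki2012, status: disputed]: "Let `v ∈ 𝕍^bad`; suppose
that `j ≠ 0`. Recall that the various monoids `Ψ_{𝓕_LGP}(−)_v` … as well as the monoids `Ψ_LGP(−)_v` … are
equipped with natural splittings up to torsion. Write `Ψ^⊥_{𝓕_LGP}(−)_v ⊆ Ψ_{𝓕_LGP}(−)_v` … for the submonoids
corresponding to these splittings [cf. the submonoids "`𝒪^⊥(−) ⊆ 𝒪^▷(−)`" discussed in [IUTchII] Definition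
4.9, (ii) …]. [Thus, the subgroup of units of "`Ψ^⊥`" consists of the `2l`-torsion subgroup of "`Ψ`" …]. Then,
as `m` ranges over the elements of `ℤ`, the actions, via the [relevant] Kummer isomorphisms of (i), of the
various monoids `Ψ^⊥_{𝓕_LGP}(^{n,m}𝓗𝓣^{Θ±ell NF})_v` … on the ind-topological modules
`𝓘^ℚ(^{S^±_{j+1},j}𝓕(^{n,∘}𝔇_≻)_v) ⊆ log(^{S^±_{j+1},j}𝓕(^{n,∘}𝔇_≻)_v)` … are mutually compatible, relative to
the log-links of the `n`-th column …, in the sense that the only portions of these actions that are possibly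
related to one another via these log-links are the indeterminacies with respect to multiplication by roots of
unity in the domains of the log-links, that is to say, indeterminacies at `m` that correspond, via the
log-link, to "addition by zero" — i.e., to no indeterminacy! — at `m + 1`." Closing paragraph, p. 106: "one
obtains a sort of "log-Kummer correspondence" between the totality, as `m` ranges over the elements of `ℤ`, of
the various groups of units and splitting monoids … and their actions … on the "`𝓘^ℚ`" labeled by "`n,∘`"
which is invariant with respect to the translation symmetries … of the `n`-th column".

abc-iut-L6-t4's statement file types clause (c) as the predicate `Prop35ii_c IQ M κ Rel` and the closing
paragraph (per-index form) as `logKummerCorrespondence' IQ M κ` (`VerticallyCoricLGP.lean`, p403950/p406711).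
The siblings discharge (a) at the genuine `p`-adic logarithms (`VerticallyCoricLGPNonarch.lean`,
`VerticallyCoricLGPPackets.lean`) and (b) at the genuine complex exponential (`VerticallyCoricLGPArch.lean`).
This file DISCHARGES (c) and the closing paragraph AT THE TREE'S MODEL OF A BAD PLACE:

* carrier (vertical coricity, Prop. 3.5 (i): ONE étale-like copy for the whole column): the coric field
  `R := K` = a mixed-characteristic ultrametric field (`NormedAlgebra ℚ_[p] K`), standing for the `α = j`
  factor `log(^{S^±_{j+1},j}𝓕(^{n,∘}𝔇_≻)_v)`; a model `Lg : PadicLogOnUnits K` of the `p`-adic logarithm on units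
  (abc-iut-L4-t3, [AbsTopIII] Def. 5.4 (iii)), log-shell `ℐ = logShell Lg`;
* `IQ := 𝓘^ℚ` = the span of (the subgroup generated by) the log-shell (abc-iut-L6-t4's `shellQSpan`, [IUTchIII]
  Prop. 3.2 (ii) p. 99 "the `ℚ`-span of `𝓘`", typed there as the `𝕜`-span), read as a `ℤ`-submodule;
  **PROVED: `𝓘^ℚ = K`** (`shellQSpan_closure_logShell_eq_top`: the log-shell contains `𝒪_K`
  — abc-iut-L4-t3's `closedBall_subset_logShell`, [IUTchIII] Rmk. 1.2.2 (i) "`𝒪 ⊆ ℐ`" — and `𝒪_K` spans `K`);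
* `M m := Ψ^⊥` = abc-iut-L6-t2's CONCRETE splitting monoid `splittingMonoidAt K 2l q j = μ_{2l}(K) · (q^{j²})^ℕ`
  ([IUTchII] Def. 4.9 (ii) / Cor. 3.5 (iii); `SplittingMonoidValues.lean` p407350) of the `2l`-th root `q = q_v`
  of the `q`-parameter (`‖q‖ < 1`) at the label `j ≠ 0`, the SAME monoid for every `m` (the Frobenius-like copies
  `Ψ^⊥_{𝓕_LGP}(^{n,m}−)_v` being identified with the coric `Ψ^⊥_LGP(^{n,∘}−)_v` by the Kummer isomorphisms of (i));
  Kummer maps `κ m :=` the inclusion `Ψ^⊥ ↪ K`;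
* `Rel m x y :=` "the portions of these actions that are possibly related to one another via these log-links"
  = BOTH `x` (at `m`) and `y` (at `m + 1`) lie in the domains of the log-links, i.e. in the local units
  (abc-iut-L6-t3's `iterDomain Lg 1`, [IUTchIII] Rmk. 1.1.1 (i) "defined only on the [local] units").

Results (all PROVED; classical `p`-adic bookkeeping over landed definitions; no new definition):
* `pow_eq_one_of_mem_splittingMonoidAt_of_norm_eq_one` — the printed bracket "[the subgroup of units of `Ψ^⊥`
  consists of the `2l`-torsion subgroup]": a unit of `μ_{2l} · q^{j²ℕ}` (`‖q‖ < 1`, `j ≠ 0`) is a `2l`-th root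
  of unity;
* `log_eq_zero_of_mem_splittingMonoidAt` — "indeterminacies at `m` that correspond, via the log-link, to
  'addition by zero' … at `m + 1`": at the genuine `log_p` (`PadicLogOnUnits.ofUnitLog`, abc-iut-L3-t11/S1) the
  log-link kills every element of `Ψ^⊥` in its domain (abc-iut-S1's `unitLog_eq_zero_of_pow_eq_one`);
* **`prop35ii_c_splittingMonoidAt` — `Prop35ii_c` HOLDS for this data**: `Ψ^⊥` acts on `𝓘^ℚ` (multiplication
  in `K`; `𝓘^ℚ = K`), and two elements related via the log-links have Kummer images differing by a root of
  unity of `K`;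
* `logKummerCorrespondence'_splittingMonoidAt`, `logKummerCorrespondence'_unitSphere` — the per-index
  log-Kummer correspondence HOLDS for the splitting monoids and for the groups of units `𝒪_K^×`: every copy
  `(n,m)` acts on the one coric `𝓘^ℚ` with the same Kummer image ("invariant with respect to the translation
  symmetries of the `n`-th column").

Honest scope: ONE factor / one place `v ∈ 𝕍^bad` (the `(S^±_{j+1}, j)`-packet version is the image of these
statements under abc-iut-L6-t4's `toPacketAt`, not spelled out here); the archimedean clause (b) at the packet
level is NOT here (one factor: `VerticallyCoricLGPArch.lean`; the packet needs the Hermitian tensor-product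
metric of `ArchimedeanShellData`, an interface). Nothing here bears on the disputed [IUTchIII] Cor. 3.12 or
takes a side; typed ≠ discharged elsewhere; instantiated ≠ endorsed.
-/

noncomputable section

namespace Literature.IUT.LogThetaLattice

open Set Metric
open Literature.AnabelianGeometry.AbsoluteAnabelian Literature.IUT.HodgeArakelov Literature.IUT.LogVolume

universe u

section BadPlace

variable (p : ℕ) [Fact p.Prime]
variable {K : Type u} [NontriviallyNormedField K] [NormedAlgebra ℚ_[p] K] [IsUltrametricDist K]
variable (Lg : PadicLogOnUnits K)

/-! ### `𝓘^ℚ = K`: the span of the log-shell of a mixed-characteristic local field is the whole field -/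

/-- **IUTchIII:Prop3.2(ii)** / **IUTchIII:Prop3.5(ii)(c)** (kurims p. 99, p. 105), at one nonarchimedean factor:
`𝓘^ℚ = K` — the span (abc-iut-L6-t4's `shellQSpan`, "the `ℚ`-span of `𝓘`", typed as the `ℚ_p`-span) of the
subgroup generated by the log-shell `ℐ` of ANY model `Lg` of the `p`-adic logarithm on units is ALL of `K`:
`ℐ ⊇ 𝒪_K` ([AbsTopIII] Def. 5.4 (iii), abc-iut-L4-t3's `closedBall_subset_logShell`; [IUTchIII] Rmk. 1.2.2 (i))
and every `x ∈ K` is `p^{-n} · (p^n x)` with `p^n x ∈ 𝒪_K`. PROVED. [claim: Mochizuki2012, status: disputed] -/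
theorem shellQSpan_closure_logShell_eq_top :
    shellQSpan ℚ_[p] (AddSubgroup.closure (logShell Lg)) = ⊤ := by
  refine Submodule.eq_top_iff'.mpr fun x => ?_
  have hprime : p.Prime := Fact.out
  have hp1 : ‖(p : ℚ_[p])‖ < 1 := by
    rw [Padic.norm_p]
    exact inv_lt_one_of_one_lt₀ (by exact_mod_cast hprime.one_lt)
  have hp0 : (p : ℚ_[p]) ≠ 0 := by exact_mod_cast hprime.ne_zero
  obtain ⟨n, hn⟩ : ∃ n : ℕ, ‖(p : ℚ_[p])‖ ^ n * ‖x‖ ≤ 1 := by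
    rcases eq_or_ne x 0 with rfl | hx
    · exact ⟨0, by simp⟩
    · have hxpos : 0 < ‖x‖ := norm_pos_iff.mpr hx
      obtain ⟨n, hn⟩ := exists_pow_lt_of_lt_one (inv_pos.mpr hxpos) hp1
      have h := mul_lt_mul_of_pos_right hn hxpos
      rw [inv_mul_cancel₀ hxpos.ne'] at h
      exact ⟨n, h.le⟩
  have hmem : ((p : ℚ_[p]) ^ n) • x ∈ shellQSpan ℚ_[p] (AddSubgroup.closure (logShell Lg)) := by
    refine shell_le_shellQSpan ℚ_[p] _ (AddSubgroup.subset_closure (closedBall_subset_logShell Lg ?_))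
    rw [mem_closedBall, dist_zero_right, norm_smul, norm_pow]
    exact hn
  have h := Submodule.smul_mem _ (((p : ℚ_[p]) ^ n)⁻¹) hmem
  rwa [smul_smul, inv_mul_cancel₀ (pow_ne_zero n hp0), one_smul] at h

/-- Hence `𝓘^ℚ`, read as a `ℤ`-submodule of the coric ring (the shape of abc-iut-L6-t4's `Prop35ii_c`), is `⊤`:
EVERY submonoid of `K` "acts multiplicatively on `𝓘^ℚ`" ([IUTchIII] Prop. 3.4 (ii) p. 103 / Prop. 3.5 (ii) (c)
p. 105, at the model). PROVED. [claim: Mochizuki2012, status: disputed] -/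
theorem mem_shellQSpan_closure_logShell (x : K) :
    x ∈ (shellQSpan ℚ_[p] (AddSubgroup.closure (logShell Lg))).restrictScalars ℤ := by
  rw [Submodule.restrictScalars_mem, shellQSpan_closure_logShell_eq_top p Lg]
  exact Submodule.mem_top

/-! ### The units of the splitting monoid `μ_{2l} · q^{j²ℕ}` are its `2l`-torsion -/

variable {twoL : ℕ} {q : K} {j : ℕ}

omit [NormedAlgebra ℚ_[p] K] [IsUltrametricDist K] in
/-- A `2l`-th root of unity of `K` (`2l > 0`) has norm `1`. [folklore] -/
private theorem norm_coe_eq_one_of_mem_rootsOfUnity (hl : 0 < twoL) {ζ : Kˣ}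
    (hζ : ζ ∈ rootsOfUnity twoL K) : ‖(ζ : K)‖ = 1 := by
  rw [mem_rootsOfUnity] at hζ
  have h1 : ‖(ζ : K)‖ ^ twoL = 1 := by
    rw [← norm_pow, ← Units.val_pow_eq_pow_val, hζ, Units.val_one, norm_one]
  exact (pow_eq_one_iff_of_nonneg (norm_nonneg _) hl.ne').mp h1

omit [NormedAlgebra ℚ_[p] K] [IsUltrametricDist K] in
/-- **IUTchIII:Prop3.5(ii)(c)** (kurims p. 105), the printed bracket "[Thus, the subgroup of units of "`Ψ^⊥`"
consists of the `2l`-torsion subgroup of "`Ψ`" …]" AT abc-iut-L6-t2's model `Ψ^⊥ = splittingMonoidAt K 2l q j =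
μ_{2l}(K) · (q^{j²})^ℕ` ([IUTchII] Def. 4.9 (ii)) of a bad place (`‖q‖ < 1`, label `j ≠ 0`, `2l > 0`): an element
of `Ψ^⊥` of norm `1` — i.e. one lying in the domain of the log-link — is a `2l`-th root of unity. PROVED.
[claim: Mochizuki2012, status: disputed] -/
theorem pow_eq_one_of_mem_splittingMonoidAt_of_norm_eq_one (hq : ‖q‖ < 1) (hj : j ≠ 0) (hl : 0 < twoL)
    {x : K} (hx : x ∈ splittingMonoidAt K twoL q j) (h1 : ‖x‖ = 1) : x ^ twoL = 1 := by
  rw [mem_splittingMonoidAt_iff] at hx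
  obtain ⟨ζ, hζ, n, rfl⟩ := hx
  have hζ1 : ‖(ζ : K)‖ = 1 := norm_coe_eq_one_of_mem_rootsOfUnity hl hζ
  have hζpow : (ζ : K) ^ twoL = 1 := by
    rw [mem_rootsOfUnity] at hζ
    rw [← Units.val_pow_eq_pow_val, hζ, Units.val_one]
  rcases Nat.eq_zero_or_pos n with rfl | hn
  · rw [pow_zero, mul_one, hζpow]
  · exfalso
    rw [norm_mul, hζ1, one_mul, norm_pow, norm_pow] at h1
    have hlt : ‖q‖ ^ j ^ 2 < 1 := pow_lt_one₀ (norm_nonneg q) hq (pow_ne_zero 2 hj)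
    have heq : ‖q‖ ^ j ^ 2 = 1 := (pow_eq_one_iff_of_nonneg (pow_nonneg (norm_nonneg q) _) hn.ne').mp h1
    exact absurd heq hlt.ne

omit [NormedAlgebra ℚ_[p] K] [IsUltrametricDist K] in
/-- Norms on the splitting monoid: every element of `μ_{2l}(K) · (q^{j²})^ℕ` has norm `‖q‖^{j²·n}` for some `n`
(the torsion factor has norm `1`). [claim: Mochizuki2012, status: disputed] -/
theorem exists_norm_eq_of_mem_splittingMonoidAt (hl : 0 < twoL) {x : K}
    (hx : x ∈ splittingMonoidAt K twoL q j) : ∃ n : ℕ, ‖x‖ = (‖q‖ ^ j ^ 2) ^ n := by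
  rw [mem_splittingMonoidAt_iff] at hx
  obtain ⟨ζ, hζ, n, rfl⟩ := hx
  exact ⟨n, by rw [norm_mul, norm_coe_eq_one_of_mem_rootsOfUnity hl hζ, one_mul, norm_pow, norm_pow]⟩

omit [NormedAlgebra ℚ_[p] K] [IsUltrametricDist K] in
/-- **IUTchIII:Rmk1.1.1(i)** / **IUTchIII:Prop3.5(ii)(c)** (kurims p. 28, p. 105): the portion of the splitting
monoid `Ψ^⊥ = μ_{2l} · q^{j²ℕ}` lying in the domain of the log-link (abc-iut-L6-t3's `iterDomain Lg 1` = the local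
units) is exactly its `2l`-torsion. PROVED. [claim: Mochizuki2012, status: disputed] -/
theorem mem_iterDomain_one_iff_pow_eq_one (hq : ‖q‖ < 1) (hj : j ≠ 0) (hl : 0 < twoL) {x : K}
    (hx : x ∈ splittingMonoidAt K twoL q j) : x ∈ iterDomain Lg 1 ↔ x ^ twoL = 1 := by
  rw [mem_iterDomain_succ, iterDomain_zero, mem_sphere_zero_iff_norm]
  constructor
  · rintro ⟨h1, -⟩
    exact pow_eq_one_of_mem_splittingMonoidAt_of_norm_eq_one hq hj hl hx h1
  · intro h
    refine ⟨?_, mem_univ _⟩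
    have h1 : ‖x‖ ^ twoL = 1 := by rw [← norm_pow, h, norm_one]
    exact (pow_eq_one_iff_of_nonneg (norm_nonneg x) hl.ne').mp h1

/-! ### Proposition 3.5 (ii) (c) at the model -/

/-- **IUTchIII:Prop3.5(ii)(c)** (kurims pp. 105–106) **"(Bad Primes)" — `Prop35ii_c` HOLDS at the tree's model
of a bad place** `v ∈ 𝕍^bad`, label `j ≠ 0`: coric ring `K` (one factor of `log(^{S^±_{j+1},j}𝓕(^{n,∘}𝔇_≻)_v)`,
vertically coric: the same for every `m`), `𝓘^ℚ =` the span of the log-shell of the model `Lg` of the `p`-adic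
logarithm (as a `ℤ`-submodule), the splitting monoids `Ψ^⊥_{𝓕_LGP}(^{n,m}−)_v := μ_{2l}(K) · (q^{j²})^ℕ`
(abc-iut-L6-t2's `splittingMonoidAt`, `‖q‖ < 1`, `2l > 0`) for every `m ∈ ℤ` with Kummer maps the inclusions,
and "related via the log-links" := both elements lie in the domains of the log-links (`iterDomain Lg 1`, the
units): (1) the splitting monoids act multiplicatively on `𝓘^ℚ` (`𝓘^ℚ = K`); (2) the only portions of these
actions related via the log-links are the `2l`-torsion ("indeterminacies with respect to multiplication by
roots of unity"): the two Kummer images differ by a root of unity `ζ = y · x⁻¹`, `ζ^{2l} = 1`. PROVED.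
[claim: Mochizuki2012, status: disputed] -/
theorem prop35ii_c_splittingMonoidAt (hq : ‖q‖ < 1) (hj : j ≠ 0) (hl : 0 < twoL) :
    Prop35ii_c (R := K) ((shellQSpan ℚ_[p] (AddSubgroup.closure (logShell Lg))).restrictScalars ℤ)
      (fun _ : ℤ => ↥(splittingMonoidAt K twoL q j))
      (fun _ => (splittingMonoidAt K twoL q j).subtype)
      (fun _ x y => (x : K) ∈ iterDomain Lg 1 ∧ (y : K) ∈ iterDomain Lg 1) := by
  refine ⟨fun _ _ _ _ => mem_shellQSpan_closure_logShell p Lg _, fun m x y hxy => ?_⟩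
  obtain ⟨hx, hy⟩ := hxy
  have hxt : (x : K) ^ twoL = 1 := (mem_iterDomain_one_iff_pow_eq_one Lg hq hj hl x.2).mp hx
  have hyt : (y : K) ^ twoL = 1 := (mem_iterDomain_one_iff_pow_eq_one Lg hq hj hl y.2).mp hy
  have hx0 : (x : K) ≠ 0 := by
    intro h0
    rw [h0, zero_pow hl.ne'] at hxt
    exact zero_ne_one hxt
  refine ⟨(y : K) * (x : K)⁻¹, ⟨twoL, hl, ?_⟩, ?_⟩
  · rw [mul_pow, inv_pow, hxt, hyt, inv_one, mul_one]
  · show (y : K) = (y : K) * (x : K)⁻¹ * (x : K)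
    rw [inv_mul_cancel_right₀ hx0]

/-- **IUTchIII:Prop3.5(ii)(c)** (kurims p. 106) "indeterminacies at `m` that correspond, via the log-link, to
"addition by zero" — i.e., to no indeterminacy! — at `m + 1`", AT THE GENUINE `p`-ADIC LOGARITHM (the
standard model `PadicLogOnUnits.ofUnitLog p K`, abc-iut-L3-t11/S1): the log-link sends every element of the
splitting monoid `μ_{2l} · q^{j²ℕ}` lying in its domain (a `2l`-th root of unity, by
`pow_eq_one_of_mem_splittingMonoidAt_of_norm_eq_one`) to `0` (abc-iut-S1's `unitLog_eq_zero_of_pow_eq_one`).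
PROVED. [claim: Mochizuki2012, status: disputed] -/
theorem log_eq_zero_of_mem_splittingMonoidAt [CompleteSpace K] [ProperSpace K] (hq : ‖q‖ < 1) (hj : j ≠ 0)
    (hl : 0 < twoL) {x : K} (hx : x ∈ splittingMonoidAt K twoL q j)
    (hd : x ∈ iterDomain (PadicLogOnUnits.ofUnitLog p K) 1) :
    (PadicLogOnUnits.ofUnitLog p K).log x = 0 := by
  rw [PadicLogOnUnits.ofUnitLog_log]
  exact unitLog_eq_zero_of_pow_eq_one p hl
    ((mem_iterDomain_one_iff_pow_eq_one (PadicLogOnUnits.ofUnitLog p K) hq hj hl hx).mp hd)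

/-- **IUTchIII:Prop3.5(ii)(c)** (kurims pp. 105–106) — the clause UNCONDITIONALLY AT THE GENUINE `p`-ADIC
LOGARITHM: `Prop35ii_c` HOLDS for the log-shell of `log_p` (`PadicLogOnUnits.ofUnitLog p K`), the splitting
monoids `μ_{2l} · q^{j²ℕ}` and "related via the log-links" = in the domains of the log-links of `log_p`.
PROVED. [claim: Mochizuki2012, status: disputed] -/
theorem prop35ii_c_splittingMonoidAt_ofUnitLog [CompleteSpace K] (hq : ‖q‖ < 1) (hj : j ≠ 0) (hl : 0 < twoL) :
    Prop35ii_c (R := K)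
      ((shellQSpan ℚ_[p] (AddSubgroup.closure (logShell (PadicLogOnUnits.ofUnitLog p K)))).restrictScalars ℤ)
      (fun _ : ℤ => ↥(splittingMonoidAt K twoL q j))
      (fun _ => (splittingMonoidAt K twoL q j).subtype)
      (fun _ x y => (x : K) ∈ iterDomain (PadicLogOnUnits.ofUnitLog p K) 1 ∧
        (y : K) ∈ iterDomain (PadicLogOnUnits.ofUnitLog p K) 1) :=
  prop35ii_c_splittingMonoidAt p (PadicLogOnUnits.ofUnitLog p K) hq hj hl

/-! ### The closing "log-Kummer correspondence" (p. 106) at the model -/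

/-- **IUTchIII:Prop3.5(ii)** closing paragraph (kurims p. 106) — the per-index **log-Kummer correspondence**
`logKummerCorrespondence'` HOLDS at the model for the SPLITTING MONOIDS: every Frobenius-like copy
`Ψ^⊥_{𝓕_LGP}(^{n,m}−)_v = μ_{2l} · q^{j²ℕ}`, `m ∈ ℤ`, acts (multiplicatively, through its Kummer image = the
inclusion into the coric `K`) on the one coric `𝓘^ℚ` labelled `(n,∘)`, and the Kummer image is the same for
`m` and `m + 1` ("invariant with respect to the translation symmetries … of the `n`-th column"). PROVED.
[claim: Mochizuki2012, status: disputed] -/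
theorem logKummerCorrespondence'_splittingMonoidAt :
    logKummerCorrespondence' (R := K)
      ((shellQSpan ℚ_[p] (AddSubgroup.closure (logShell Lg))).restrictScalars ℤ)
      (fun _ : ℤ => ↥(splittingMonoidAt K twoL q j))
      (fun _ => (splittingMonoidAt K twoL q j).subtype) :=
  ⟨fun _ _ _ _ => mem_shellQSpan_closure_logShell p Lg _, fun _ => rfl⟩

/-- **IUTchIII:Prop3.5(ii)** closing paragraph (kurims p. 106) — the per-index **log-Kummer correspondence**
`logKummerCorrespondence'` HOLDS at the model for the GROUPS OF UNITS: every Frobenius-like copy of the local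
units `𝒪_K^× = {‖x‖ = 1}` (Mathlib's `Submonoid.unitSphere K`), `m ∈ ℤ`, acts on the coric `𝓘^ℚ` through its
Kummer image (the inclusion, the same for every `m`). PROVED. [claim: Mochizuki2012, status: disputed] -/
theorem logKummerCorrespondence'_unitSphere :
    logKummerCorrespondence' (R := K)
      ((shellQSpan ℚ_[p] (AddSubgroup.closure (logShell Lg))).restrictScalars ℤ)
      (fun _ : ℤ => ↥(Submonoid.unitSphere K))
      (fun _ => (Submonoid.unitSphere K).subtype) :=
  ⟨fun _ _ _ _ => mem_shellQSpan_closure_logShell p Lg _, fun _ => rfl⟩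

/-- Consequently the union form `logKummerCorrespondence` of abc-iut-L6-t4 also HOLDS at the model for the
splitting monoids (abc-iut-L6-t4's `logKummerCorrespondence'.toUnion`). PROVED.
[claim: Mochizuki2012, status: disputed] -/
theorem logKummerCorrespondence_splittingMonoidAt :
    logKummerCorrespondence (R := K)
      ((shellQSpan ℚ_[p] (AddSubgroup.closure (logShell Lg))).restrictScalars ℤ)
      (fun _ : ℤ => ↥(splittingMonoidAt K twoL q j))
      (fun _ => (splittingMonoidAt K twoL q j).subtype) :=
  (logKummerCorrespondence'_splittingMonoidAt p Lg).toUnion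

end BadPlace

end Literature.IUT.LogThetaLattice

end

/-! ### Appended: the printed bracket of Prop. 3.5 (ii) (c) literally, for the units OF THE MONOID `Ψ^⊥` -/

namespace Literature.IUT.LogThetaLattice

open Literature.IUT.HodgeArakelov

universe u'

section UnitsOfSplittingMonoid

variable {K : Type u'} [NontriviallyNormedField K] {twoL : ℕ} {q : K} {j : ℕ}

/-- Every element of the splitting monoid `μ_{2l} · q^{j²ℕ}` (`‖q‖ < 1`) has norm `≤ 1`.
[claim: Mochizuki2012, status: disputed] -/
theorem norm_le_one_of_mem_splittingMonoidAt (hq : ‖q‖ < 1) (hl : 0 < twoL) {x : K}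
    (hx : x ∈ splittingMonoidAt K twoL q j) : ‖x‖ ≤ 1 := by
  obtain ⟨n, hn⟩ := exists_norm_eq_of_mem_splittingMonoidAt hl hx
  rw [hn]
  exact pow_le_one₀ (pow_nonneg (norm_nonneg q) _) (pow_le_one₀ (norm_nonneg q) hq.le)

/-- **IUTchIII:Prop3.5(ii)(c)** (kurims p. 105), the printed bracket LITERALLY — "[Thus, the subgroup of
units of "`Ψ^⊥`" consists of the `2l`-torsion subgroup of "`Ψ`" …]": an element of the MONOID
`Ψ^⊥ = μ_{2l}(K) · (q^{j²})^ℕ` (abc-iut-L6-t2's `splittingMonoidAt`, `‖q‖ < 1`, `j ≠ 0`, `2l > 0`) is a unit OF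
THAT MONOID iff it is `2l`-torsion (answering audit note INFO-1 of abc-iut-w4-d004 on p411733: the bracket
speaks of units of the monoid, not of norm-one elements; at the model the two coincide). PROVED.
[claim: Mochizuki2012, status: disputed] -/
theorem isUnit_splittingMonoidAt_iff_pow_eq_one (hq : ‖q‖ < 1) (hj : j ≠ 0) (hl : 0 < twoL)
    (x : ↥(splittingMonoidAt K twoL q j)) : IsUnit x ↔ (x : K) ^ twoL = 1 := by
  constructor
  · rintro ⟨u, rfl⟩
    have hab : (u.val : K) * (u.inv : K) = 1 := by
      have h := congrArg (fun z : ↥(splittingMonoidAt K twoL q j) => (z : K)) u.val_inv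
      simpa only [Submonoid.coe_mul, Submonoid.coe_one] using h
    have hx1 : ‖(u.val : K)‖ ≤ 1 := norm_le_one_of_mem_splittingMonoidAt hq hl u.val.2
    have hy1 : ‖(u.inv : K)‖ ≤ 1 := norm_le_one_of_mem_splittingMonoidAt hq hl u.inv.2
    have h1 : ‖(u.val : K)‖ = 1 := by
      by_contra hne
      have hlt : ‖(u.val : K) * (u.inv : K)‖ < 1 := by
        rw [norm_mul]
        exact mul_lt_one_of_nonneg_of_lt_one_left (norm_nonneg _) (lt_of_le_of_ne hx1 hne) hy1
      rw [hab, norm_one] at hlt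
      exact lt_irrefl _ hlt
    exact pow_eq_one_of_mem_splittingMonoidAt_of_norm_eq_one hq hj hl u.val.2 h1
  · intro h
    have h' : x ^ twoL = 1 :=
      Subtype.ext (by rw [SubmonoidClass.coe_pow, OneMemClass.coe_one]; exact h)
    exact (Units.ofPowEqOne x twoL h' hl.ne').isUnit

end UnitsOfSplittingMonoid

end Literature.IUT.LogThetaLattice
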